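import Literature.NumberTheory.EllipticCurves.BinaryQuarticDiscriminantFpCountProofs
import Mathlib.Tactic.IntervalCases
import HarnessLib

/-!
# `W_p = {p² ∣ Δ}` for binary quartic forms: unique lifts modulo `p²`, the density bound
# `#{f mod p² : p² ∣ Δ(f)} ≤ 10p⁸`, and strong/weak divisibility

`Proofs` companion (theorems only) of `BinaryQuarticDiscriminantStrata.lean` and
`BinaryQuarticDiscriminantFpCountProofs.lean`. Source: M. Bhargava, A. Shankar, *Binary quartic
forms having bounded invariants, and the boundedness of the average rank of elliptic curves*, Ann.
of Math. (2) 181 (2015) 191–242, §2.6–2.7 of the published version (= arXiv:1006.1002v3), where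
`W_p ⊂ V_ℤ` is the set of integral binary quartic forms with `p² ∣ Δ(f)`, partitioned into the
forms whose discriminant is *strongly divisible* by `p²` (`p² ∣ Δ(f + pg)` for all `g`;
`W_p^{(1)}`) and *weakly divisible* (`W_p^{(2)}`). Proved here:

* `e_eq_of_disc_eq_zero_of_discDerivE_ne_zero` — **the unique lift** (proof of Thm 2.20: "Since
  `p ∤ ∂Δ/∂e`, each such residue modulo `p` has a unique lift modulo `p²` such that `p² ∣ Δ`"):
  over `ℤ/p²`, two zeros of `Δ` with the same `a, b, c, d`, congruent `e`, and
  `∂Δ/∂e ≢ 0 (mod p)` coincide (Taylor's formula `disc_add_e` and `h² = 0` for `h ∈ pℤ/p²ℤ`);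
* `card_filter_disc_eq_zero_discDerivE_ne_zero_sq_le`: hence the zeros of `Δ` in `V(ℤ/p²)` with
  `∂Δ/∂e ≢ 0` number `≤ #{Δ ≡ 0 (mod p)} · p⁴`; and `card_filter_map_mem_le`: the forms reducing
  into a set `T ⊆ V(ℤ/p)` number `≤ #T · p⁵`;
* `card_filter_disc_eq_zero_sq_le` — **`#{f ∈ V(ℤ/p²) : Δ(f) = 0} ≤ 10·p⁸` for every prime `p`**,
  i.e. `W_p` has density `≤ 10/p²` in `V_{ℤ_p}`: the estimate
  `∫_{f ∈ V_{ℤ_p}, p² ∣ Δ(f)} df ≪ p⁻²` invoked in the proof of Thm 2.21 (the square-free sieve;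
  there attributed to [BPS, proof of Thm 3.2]) and the tail bound behind the convergence of
  `∏_p ∫ φ_p`;
* the dictionary with `V_ℤ`: `sq_dvd_disc_iff_disc_map_eq_zero` (`p² ∣ Δ(f)` iff
  `Δ(f mod p²) = 0`), `dvd_disc_and_dvd_discDerivE_of_forall_sq_dvd` (strong divisibility, already
  in the `e`-direction alone, forces `f mod p ∈ Y = {Δ = ∂Δ/∂e = 0}` — the remark justifying
  Thm 2.18), and `not_sq_dvd_disc_add_of_not_dvd_discDerivE` (`p² ∣ Δ`, `p ∤ ∂Δ/∂e` is weak
  divisibility). Note on the source: the proof of Thm 2.20 says a form of `W_p^{(2)}` has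
  `p ∤ ∂Δ/∂e` "for otherwise `f` would belong to `W_p^{(1)}`"; what the two lemmas give is the
  partition `W_p = {p ∣ ∂Δ/∂e} ⊔ {p ∤ ∂Δ/∂e}` with the first part reducing into `Y(𝔽_p)` (all that
  Thm 2.18 uses) and the second part weakly divisible (all that Thms 2.19–2.20 use).

## References

* M. Bhargava, A. Shankar, Ann. of Math. (2) 181 (2015), §2.6 (Thms 2.18–2.20) and §2.7 (proof of
  Thm 2.21) of the published version (= arXiv:1006.1002v3). [cite: BhargavaShankarAnnals2015, §2.6–2.7 (published numbering)]
* K. Belabas, M. Bhargava, C. Pomerance, *Error estimates for the Davenport–Heilbronn theorems*,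
  Duke Math. J. 153 (2010) (`BPS`, cited through the source).
-/

noncomputable section

open scoped Classical

namespace Literature.NumberTheory.EllipticCurves

namespace BinaryQuartic

open Finset

section Lift

variable {p : ℕ} [hp : Fact p.Prime]

/-! ## `ℤ/p²`: reduction, `p`-adic digits, the kernel of reduction -/

/-- The reduction `ℤ/p² → ℤ/p` on canonical representatives: `(x mod p).val = x.val % p`. [folklore] -/
theorem val_castHom_sq (x : ZMod (p ^ 2)) :
    (ZMod.castHom (dvd_pow_self p two_ne_zero) (ZMod p) x).val = x.val % p := by
  rw [ZMod.castHom_apply, ZMod.cast_eq_val, ZMod.val_natCast]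

/-- An element of `ℤ/p²` is determined by its reduction modulo `p` and its second `p`-adic digit
`x.val / p`. [folklore] -/
theorem eq_of_castHom_eq_of_div_eq {x y : ZMod (p ^ 2)}
    (h₁ : ZMod.castHom (dvd_pow_self p two_ne_zero) (ZMod p) x =
      ZMod.castHom (dvd_pow_self p two_ne_zero) (ZMod p) y)
    (h₂ : x.val / p = y.val / p) : x = y := by
  have h₁' : x.val % p = y.val % p := by
    rw [← val_castHom_sq, ← val_castHom_sq, h₁]
  apply ZMod.val_injective
  rw [← Nat.div_add_mod x.val p, ← Nat.div_add_mod y.val p, h₁', h₂]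

/-- The second `p`-adic digit of an element of `ℤ/p²` is `< p`. [folklore] -/
theorem val_div_lt (x : ZMod (p ^ 2)) : x.val / p < p :=
  Nat.div_lt_of_lt_mul (by rw [← sq]; exact x.val_lt)

/-- The kernel of `ℤ/p² → ℤ/p` has square zero: if `x ≡ 0 (mod p)` then `x² = 0` in `ℤ/p²`. [folklore] -/
theorem sq_eq_zero_of_castHom_eq_zero {x : ZMod (p ^ 2)}
    (h : ZMod.castHom (dvd_pow_self p two_ne_zero) (ZMod p) x = 0) : x ^ 2 = 0 := by
  have h0 : x.val % p = 0 := by rw [← val_castHom_sq, h, ZMod.val_zero]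
  obtain ⟨k, hk⟩ := Nat.dvd_of_mod_eq_zero h0
  have hx : x = ((p * k : ℕ) : ZMod (p ^ 2)) := by rw [← hk, ZMod.natCast_zmod_val]
  rw [hx, Nat.cast_mul, mul_pow, ← Nat.cast_pow, ZMod.natCast_self, zero_mul]

/-- An element of `ℤ/p²` whose reduction modulo `p` is nonzero is a unit. [folklore] -/
theorem isUnit_of_castHom_ne_zero {x : ZMod (p ^ 2)}
    (h : ZMod.castHom (dvd_pow_self p two_ne_zero) (ZMod p) x ≠ 0) : IsUnit x := by
  have hndvd : ¬ p ∣ x.val := by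
    intro hdvd
    apply h
    rw [← ZMod.val_eq_zero, val_castHom_sq]
    exact Nat.eq_zero_of_dvd_of_lt ((Nat.dvd_mod_iff dvd_rfl).mpr hdvd) (Nat.mod_lt _ hp.out.pos)
  rw [← ZMod.natCast_zmod_val x, ZMod.isUnit_iff_coprime]
  exact (Nat.coprime_comm.mp ((Nat.Prime.coprime_iff_not_dvd hp.out).mpr hndvd)).pow_right 2

/-- Coefficients of forms over `ℤ/p²` with the same reduction and the same second digits agree. [folklore] -/
theorem coeffs_eq_of_map_eq_of_div_eq {F F' : BinaryQuartic (ZMod (p ^ 2))}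
    (h : F.map (ZMod.castHom (dvd_pow_self p two_ne_zero) (ZMod p)) =
      F'.map (ZMod.castHom (dvd_pow_self p two_ne_zero) (ZMod p)))
    {i : Fin 5} (hi : (F.coeffs i).val / p = (F'.coeffs i).val / p) : F.coeffs i = F'.coeffs i := by
  refine eq_of_castHom_eq_of_div_eq ?_ hi
  rw [← coeffs_map, ← coeffs_map, h]

/-! ## The unique lift (Bhargava–Shankar, proof of Thm 2.20) -/

/-- **Unique lift modulo `p²`.** Let `F, F'` be forms over `ℤ/p²` with `Δ(F) = Δ(F') = 0`, the
same coefficients `a, b, c, d`, and `e(F') ≡ e(F) (mod p)`. If `∂Δ/∂e(F) ≢ 0 (mod p)` then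
`e(F') = e(F)`: "Since `p ∤ ∂Δ/∂e`, each such residue modulo `p` has a unique lift modulo `p²`
such that `p² ∣ Δ`" (Bhargava–Shankar 2015, proof of Thm 2.20). Proof: with `h = e(F') − e(F)`,
`h² = 0` in `ℤ/p²` and Taylor (`disc_add_e`) gives `0 = Δ(F') = Δ(F) + h·∂Δ/∂e(F) = h·(unit)`.
[cite: BhargavaShankarAnnals2015, §2.6, proof of Thm 2.20 (published numbering)] -/
theorem e_eq_of_disc_eq_zero_of_discDerivE_ne_zero {F F' : BinaryQuartic (ZMod (p ^ 2))}
    (hΔ : F.disc = 0) (hΔ' : F'.disc = 0) (ha : F'.a = F.a) (hb : F'.b = F.b) (hc : F'.c = F.c)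
    (hd : F'.d = F.d)
    (he : ZMod.castHom (dvd_pow_self p two_ne_zero) (ZMod p) F'.e =
      ZMod.castHom (dvd_pow_self p two_ne_zero) (ZMod p) F.e)
    (hu : (F.map (ZMod.castHom (dvd_pow_self p two_ne_zero) (ZMod p))).discDerivE ≠ 0) :
    F'.e = F.e := by
  set h := F'.e - F.e with hh
  have hF' : F' = ⟨F.a, F.b, F.c, F.d, F.e + h⟩ := by
    ext
    · exact ha
    · exact hb
    · exact hc
    · exact hd
    · simp only [hh]; ring
  have hsq : h ^ 2 = 0 := sq_eq_zero_of_castHom_eq_zero (by rw [hh, map_sub, he, sub_self])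
  have hunit : IsUnit F.discDerivE := isUnit_of_castHom_ne_zero (by rwa [discDerivE_map] at hu)
  have key := disc_add_e F h
  rw [← hF', hΔ', hΔ, hsq, zero_mul, add_zero, zero_add, eq_comm, hunit.mul_left_eq_zero] at key
  exact sub_eq_zero.mp key

/-! ## Counting lifts -/

/-- **Fibres of reduction have `p⁵` elements**: for any set `T` of forms over `ℤ/p`, the forms over
`ℤ/p²` reducing into `T` number at most `#T · p⁵` (injectivity of `F ↦ (F mod p, second digits)`). [folklore] -/
theorem card_filter_map_mem_le (T : Finset (BinaryQuartic (ZMod p))) :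
    (univ.filter fun F : BinaryQuartic (ZMod (p ^ 2)) =>
        F.map (ZMod.castHom (dvd_pow_self p two_ne_zero) (ZMod p)) ∈ T).card ≤ T.card * p ^ 5 := by
  have h := card_le_card_of_injOn (s := univ.filter fun F : BinaryQuartic (ZMod (p ^ 2)) =>
        F.map (ZMod.castHom (dvd_pow_self p two_ne_zero) (ZMod p)) ∈ T)
    (t := T ×ˢ Fintype.piFinset fun _ : Fin 5 => range p)
    (fun F => (F.map (ZMod.castHom (dvd_pow_self p two_ne_zero) (ZMod p)),
      fun i => (F.coeffs i).val / p)) (fun F hF => ?_) ?_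
  · simpa [card_product, Fintype.card_piFinset, prod_const, card_range] using h
  · simp only [coe_filter, mem_univ, true_and, Set.mem_setOf_eq] at hF
    simp only [coe_product, Set.mem_prod, mem_coe, hF, true_and, Fintype.coe_piFinset,
      Set.mem_pi, Set.mem_univ, coe_range, Set.mem_Iio, forall_const]
    exact fun i => val_div_lt _
  · intro F _ F' _ hFF'
    simp only [Prod.mk.injEq] at hFF'
    apply coeffs_injective
    funext i
    exact coeffs_eq_of_map_eq_of_div_eq hFF'.1 (congrFun hFF'.2 i)

/-- **Forms over `ℤ/p²` with `Δ = 0` and `∂Δ/∂e ≢ 0 (mod p)` number at most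
`#{f̄ ∈ V(ℤ/p) : Δ(f̄) = 0} · p⁴`**: such a form is determined by its reduction and the second digits
of `a, b, c, d` (the digit of `e` being forced: `e_eq_of_disc_eq_zero_of_discDerivE_ne_zero`).
This is the count behind eq. `#{R_X ∩ W_p^{(2)}} = O(X^{5/6}/p² …)` in the proof of Thm 2.20 of
Bhargava–Shankar 2015. [cite: BhargavaShankarAnnals2015, §2.6, proof of Thm 2.20 (published numbering)] -/
theorem card_filter_disc_eq_zero_discDerivE_ne_zero_sq_le :
    (univ.filter fun F : BinaryQuartic (ZMod (p ^ 2)) => F.disc = 0 ∧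
        (F.map (ZMod.castHom (dvd_pow_self p two_ne_zero) (ZMod p))).discDerivE ≠ 0).card ≤
      (univ.filter fun f : BinaryQuartic (ZMod p) => f.disc = 0).card * p ^ 4 := by
  have h := card_le_card_of_injOn (s := univ.filter fun F : BinaryQuartic (ZMod (p ^ 2)) =>
        F.disc = 0 ∧ (F.map (ZMod.castHom (dvd_pow_self p two_ne_zero) (ZMod p))).discDerivE ≠ 0)
    (t := (univ.filter fun f : BinaryQuartic (ZMod p) => f.disc = 0) ×ˢ
      Fintype.piFinset fun _ : Fin 4 => range p)
    (fun F => (F.map (ZMod.castHom (dvd_pow_self p two_ne_zero) (ZMod p)),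
      fun j : Fin 4 => (F.coeffs j.castSucc).val / p)) (fun F hF => ?_) ?_
  · simpa [card_product, Fintype.card_piFinset, prod_const, card_range] using h
  · simp only [coe_filter, mem_univ, true_and, Set.mem_setOf_eq] at hF
    simp only [coe_product, Set.mem_prod, coe_filter, mem_univ, true_and, Set.mem_setOf_eq,
      disc_map, hF.1, map_zero, Fintype.coe_piFinset, Set.mem_pi, Set.mem_univ, coe_range,
      Set.mem_Iio, forall_const]
    exact fun j => val_div_lt _
  · intro F hF F' hF' hFF'
    simp only [coe_filter, mem_univ, true_and, Set.mem_setOf_eq] at hF hF'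
    simp only [Prod.mk.injEq] at hFF'
    obtain ⟨hred, hdig⟩ := hFF'
    have hco : ∀ j : Fin 4, F.coeffs j.castSucc = F'.coeffs j.castSucc := fun j =>
      coeffs_eq_of_map_eq_of_div_eq hred (congrFun hdig j)
    have ha : F'.a = F.a := by simpa using (hco 0).symm
    have hb : F'.b = F.b := by simpa using (hco 1).symm
    have hc : F'.c = F.c := by simpa using (hco 2).symm
    have hd : F'.d = F.d := by simpa using (hco 3).symm
    have he : ZMod.castHom (dvd_pow_self p two_ne_zero) (ZMod p) F'.e =
        ZMod.castHom (dvd_pow_self p two_ne_zero) (ZMod p) F.e := by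
      simpa using (congrArg BinaryQuartic.e hred).symm
    ext
    · exact ha.symm
    · exact hb.symm
    · exact hc.symm
    · exact hd.symm
    · exact (e_eq_of_disc_eq_zero_of_discDerivE_ne_zero hF.1 hF'.1 ha hb hc hd he hF.2).symm

/-- **At most `3` lifts per `(a, b, c, d)`** — the count of the proof of Thm 2.20 of
Bhargava–Shankar 2015 in its sharp per-fibre form: for `p ≥ 5` and fixed `a, b, c, d ∈ ℤ/p²`, at
most `3` residues `e ∈ ℤ/p²` give a form with `Δ = 0` and `∂Δ/∂e ≢ 0 (mod p)` ("at most `3`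
choices for the residue of `e₀ (mod p)` such that `p ∣ Δ`" and "each such residue modulo `p` has a
unique lift modulo `p²`"; when `p ∣ a, p ∣ b` one has `p ∣ ∂Δ/∂e`, so no such `e` at all).
[cite: BhargavaShankarAnnals2015, §2.6, proof of Thm 2.20 (published numbering)] -/
theorem card_filter_abcd_disc_eq_zero_sq_le_three (hp5 : 5 ≤ p) (a b c d : ZMod (p ^ 2)) :
    (univ.filter fun F : BinaryQuartic (ZMod (p ^ 2)) => F.a = a ∧ F.b = b ∧ F.c = c ∧ F.d = d ∧
        F.disc = 0 ∧ (F.map (ZMod.castHom (dvd_pow_self p two_ne_zero) (ZMod p))).discDerivE ≠ 0).card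
      ≤ 3 := by
  have hp2 : p ≠ 2 := by omega
  have hp3 : p ≠ 3 := by omega
  set red := ZMod.castHom (dvd_pow_self p two_ne_zero) (ZMod p) with hred
  -- the reductions of the forms in question, and injectivity of reduction on them (unique lift)
  have hinj : Set.InjOn (fun F : BinaryQuartic (ZMod (p ^ 2)) => F.map red)
      ↑(univ.filter fun F : BinaryQuartic (ZMod (p ^ 2)) => F.a = a ∧ F.b = b ∧ F.c = c ∧
        F.d = d ∧ F.disc = 0 ∧ (F.map red).discDerivE ≠ 0) := by
    intro F hF F' hF' h
    simp only [coe_filter, mem_univ, true_and, Set.mem_setOf_eq] at hF hF'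
    obtain ⟨rfl, rfl, rfl, rfl, hΔ, hu⟩ := hF
    obtain ⟨ha, hb, hc, hd, hΔ', -⟩ := hF'
    have he : red F'.e = red F.e := by simpa using (congrArg BinaryQuartic.e h).symm
    ext <;> [exact ha.symm; exact hb.symm; exact hc.symm; exact hd.symm;
      exact (e_eq_of_disc_eq_zero_of_discDerivE_ne_zero hΔ hΔ' ha hb hc hd he hu).symm]
  by_cases ha : red a = 0
  · by_cases hb : red b = 0
    · -- `p ∣ a`, `p ∣ b`: then `p ∣ ∂Δ/∂e`, the set is empty
      rw [Finset.card_eq_zero.mpr (filter_eq_empty_iff.mpr fun F _ hF => ?_)]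
      · norm_num
      obtain ⟨rfl, rfl, -, -, -, hu⟩ := hF
      apply hu
      have hA : (F.map red).a = 0 := by rw [map_a]; exact ha
      have hB : (F.map red).b = 0 := by rw [map_b]; exact hb
      rw [discDerivE, hA, hB]
      ring
    · refine ((card_le_card_of_injOn _ (fun F hF => ?_) hinj).trans
        (card_filter_disc_eq_zero_of_a_eq_zero_le_two hp3 hb (red c) (red d))).trans (by norm_num)
      simp only [coe_filter, mem_univ, true_and, Set.mem_setOf_eq] at hF ⊢
      obtain ⟨rfl, rfl, rfl, rfl, hΔ, -⟩ := hF
      exact ⟨by rw [map_a]; exact ha, rfl, rfl, rfl, by rw [disc_map, hΔ, map_zero]⟩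
  · refine (card_le_card_of_injOn _ (fun F hF => ?_) hinj).trans
      (card_filter_disc_eq_zero_of_abcd_le_three hp2 ha (red b) (red c) (red d))
    simp only [coe_filter, mem_univ, true_and, Set.mem_setOf_eq] at hF ⊢
    obtain ⟨rfl, rfl, rfl, rfl, hΔ, -⟩ := hF
    exact ⟨rfl, rfl, rfl, rfl, by rw [disc_map, hΔ, map_zero]⟩

/-- **`#{f mod p² : p² ∣ Δ(f)} ≤ 10·p⁸` for every prime `p`**, i.e. the density of
`W_p = {f ∈ V_{ℤ_p} : p² ∣ Δ(f)}` is at most `10/p²` — the estimate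
`∫_{f ∈ V_{ℤ_p}, p² ∣ Δ(f)} df ≪ p⁻²` of the proof of Thm 2.21 of Bhargava–Shankar 2015 (there
attributed to [BPS, proof of Thm 3.2]), at the finite level `V(ℤ/p²)`. Proof for `p ≥ 5`: split by
`∂Δ/∂e ≢ 0 (mod p)` (`≤ (3p⁴ + 3p³)·p⁴`, unique lifts over the zeros of `Δ̄`) and `∂Δ/∂e ≡ 0`
(`≤ 6p³·p⁵`, all lifts of `Y(ℤ/p)`); for `p ∈ {2, 3}` the bound exceeds `p¹⁰`.
[cite: BhargavaShankarAnnals2015, §2.7, proof of Thm 2.21 (published numbering)] -/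
theorem card_filter_disc_eq_zero_sq_le (p : ℕ) [hp : Fact p.Prime] :
    (univ.filter fun F : BinaryQuartic (ZMod (p ^ 2)) => F.disc = 0).card ≤ 10 * p ^ 8 := by
  by_cases hp5 : 5 ≤ p
  · have h₁ := card_filter_disc_eq_zero_discDerivE_ne_zero_sq_le (p := p)
    have h₂ := card_filter_map_mem_le (p := p)
      (univ.filter fun f : BinaryQuartic (ZMod p) => f.disc = 0 ∧ f.discDerivE = 0)
    have hY := card_filter_disc_eq_zero_discDerivE_eq_zero_le hp5
    have hZ := card_filter_disc_eq_zero_le hp5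
    have hp7 : 3 * p ^ 7 ≤ p ^ 8 := by
      calc 3 * p ^ 7 ≤ p * p ^ 7 := Nat.mul_le_mul_right _ (by omega)
        _ = p ^ 8 := by ring
    calc _ ≤ ((univ.filter fun F : BinaryQuartic (ZMod (p ^ 2)) => F.disc = 0 ∧
              (F.map (ZMod.castHom (dvd_pow_self p two_ne_zero) (ZMod p))).discDerivE ≠ 0) ∪
            (univ.filter fun F : BinaryQuartic (ZMod (p ^ 2)) =>
              F.map (ZMod.castHom (dvd_pow_self p two_ne_zero) (ZMod p)) ∈
                (univ.filter fun f : BinaryQuartic (ZMod p) =>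
                  f.disc = 0 ∧ f.discDerivE = 0))).card := by
          refine card_le_card fun F hF => ?_
          simp only [mem_union, mem_filter, mem_univ, true_and, disc_map, discDerivE_map] at hF ⊢
          by_cases hu : ZMod.castHom (dvd_pow_self p two_ne_zero) (ZMod p) F.discDerivE = 0
          · exact Or.inr ⟨by rw [hF, map_zero], hu⟩
          · exact Or.inl ⟨hF, hu⟩
      _ ≤ (3 * p ^ 4 + 3 * p ^ 3) * p ^ 4 + 6 * p ^ 3 * p ^ 5 := (card_union_le _ _).trans
          (add_le_add (h₁.trans (Nat.mul_le_mul_right _ hZ)) (h₂.trans (Nat.mul_le_mul_right _ hY)))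
      _ = 9 * p ^ 8 + 3 * p ^ 7 := by ring
      _ ≤ 10 * p ^ 8 := by omega
  · -- `p = 2, 3`: the trivial bound `p¹⁰ ≤ 10 p⁸`
    have hp2 := hp.out.two_le
    have hcases : p = 2 ∨ p = 3 := by
      interval_cases p
      · exact Or.inl rfl
      · exact Or.inr rfl
      · exact absurd hp.out (by decide)
    calc _ ≤ (univ : Finset (BinaryQuartic (ZMod (p ^ 2)))).card := card_filter_le _ _
      _ = (p ^ 2) ^ 5 := by rw [card_univ, card_eq, ZMod.card]
      _ ≤ 10 * p ^ 8 := by rcases hcases with rfl | rfl <;> norm_num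

end Lift

/-! ## Dictionary with `W_p ⊂ V_ℤ`: strong and weak divisibility by `p²` -/

section Integral

/-- Moving `e` by a multiple of `p` changes `Δ` modulo `p²` by `p·t·∂Δ/∂e`:
`Δ(a,b,c,d,e + p t) = Δ(f) + p t·∂Δ/∂e(f) + p²·(…)` (from `disc_add_e`). [folklore] -/
theorem sq_dvd_disc_add_iff (f : BinaryQuartic ℤ) (p t : ℤ) :
    p ^ 2 ∣ (⟨f.a, f.b, f.c, f.d, f.e + p * t⟩ : BinaryQuartic ℤ).disc ↔
      p ^ 2 ∣ f.disc + p * t * f.discDerivE := by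
  rw [disc_add_e, mul_pow, mul_assoc (p ^ 2), (dvd_add_left (dvd_mul_right (p ^ 2) _))]

/-- **Strong divisibility forces `f mod p ∈ Y`.** If `p² ∣ Δ(f + p g)` for all integral `g` — it
suffices to move the last coefficient: `p² ∣ Δ(a,b,c,d,e + p t)` for all `t` — then `p ∣ Δ(f)` and
`p ∣ ∂Δ/∂e(f)`: "if an element `v ∈ V_ℤ` has discriminant strongly divisible by `p²`, then it lies
in `Y(𝔽_p)`, where `Y` is the codimension 2 subscheme of `V ≅ 𝔸⁵` defined by the vanishing of
`Δ` and `∂Δ/∂e`" (Bhargava–Shankar 2015, §2.6, justification of Thm 2.18).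
[cite: BhargavaShankarAnnals2015, §2.6, paragraph after Thm 2.18 (published numbering)] -/
theorem dvd_disc_and_dvd_discDerivE_of_forall_sq_dvd (f : BinaryQuartic ℤ) {p : ℤ} (hp : Prime p)
    (h : ∀ t : ℤ, p ^ 2 ∣ (⟨f.a, f.b, f.c, f.d, f.e + p * t⟩ : BinaryQuartic ℤ).disc) :
    p ∣ f.disc ∧ p ∣ f.discDerivE := by
  have h0 := h 0
  have h1 := h 1
  rw [sq_dvd_disc_add_iff] at h0 h1
  simp only [mul_zero, zero_mul, add_zero] at h0
  rw [mul_one, dvd_add_right h0, sq, mul_dvd_mul_iff_left hp.ne_zero] at h1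
  exact ⟨(dvd_pow_self p two_ne_zero).trans h0, h1⟩

/-- **`p² ∣ Δ(f)` with `p ∤ ∂Δ/∂e(f)` is weak divisibility**: then `p² ∤ Δ(a,b,c,d,e + p)`, so
`f ∉ W_p^{(1)}` (the strongly divisible forms) — the dichotomy used in the proof of Thm 2.20 of
Bhargava–Shankar 2015 ("we must have `p² ∣ Δ` and `p ∤ ∂Δ/∂e` (for otherwise `f` would belong to
`W_p^{(1)}`)"), in the direction that makes the partition `W_p = {p ∣ ∂Δ/∂e} ⊔ {p ∤ ∂Δ/∂e}` fit
both Thm 2.18 (`⊆ Y(𝔽_p)`) and Thm 2.19 (weakly divisible). [cite: BhargavaShankarAnnals2015, §2.6, proof of Thm 2.20 (published numbering)] -/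
theorem not_sq_dvd_disc_add_of_not_dvd_discDerivE (f : BinaryQuartic ℤ) {p : ℤ} (hp : Prime p)
    (hΔ : p ^ 2 ∣ f.disc) (hΔe : ¬ p ∣ f.discDerivE) :
    ¬ p ^ 2 ∣ (⟨f.a, f.b, f.c, f.d, f.e + p * 1⟩ : BinaryQuartic ℤ).disc := by
  rw [sq_dvd_disc_add_iff, dvd_add_right hΔ, mul_one, sq, mul_dvd_mul_iff_left hp.ne_zero]
  exact hΔe

/-- `p² ∣ Δ(f)` for an integral form is the vanishing of `Δ(f mod p²)` in `ℤ/p²` — the dictionary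
between `W_p = {f ∈ V_ℤ : p² ∣ Δ(f)}` (Bhargava–Shankar 2015, §2.6) and the count
`card_filter_disc_eq_zero_sq_le`. [cite: BhargavaShankarAnnals2015, §2.6 (definition of W_p; published numbering)] -/
theorem sq_dvd_disc_iff_disc_map_eq_zero (f : BinaryQuartic ℤ) (n : ℕ) :
    (n : ℤ) ^ 2 ∣ f.disc ↔ (f.map (Int.castRingHom (ZMod (n ^ 2)))).disc = 0 := by
  rw [disc_map, eq_intCast, ZMod.intCast_zmod_eq_zero_iff_dvd]
  push_cast
  exact Iff.rfl

/-- Likewise `p ∣ Δ(f)`, `p ∣ ∂Δ/∂e(f)` is membership of `f mod p` in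
`Y(ℤ/p) = {Δ = ∂Δ/∂e = 0}` (counted by `card_filter_disc_eq_zero_discDerivE_eq_zero_le`). [folklore] -/
theorem dvd_disc_and_dvd_discDerivE_iff (f : BinaryQuartic ℤ) (n : ℕ) :
    ((n : ℤ) ∣ f.disc ∧ (n : ℤ) ∣ f.discDerivE) ↔
      ((f.map (Int.castRingHom (ZMod n))).disc = 0 ∧
        (f.map (Int.castRingHom (ZMod n))).discDerivE = 0) := by
  rw [disc_map, discDerivE_map, eq_intCast, eq_intCast, ZMod.intCast_zmod_eq_zero_iff_dvd,
    ZMod.intCast_zmod_eq_zero_iff_dvd]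

end Integral

end BinaryQuartic

end Literature.NumberTheory.EllipticCurves

end
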